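/-
COR-CM (cell pub-hodgecm2, stage 2 of the Hodge ladder) — count-neutral KERNEL COMBINATORICS «census ↔ tree dictionary, part 8: HINTED,
kernel-economic side checks» (seat prover-pub-hodgecm2-b23-g35-0, binder prover b23, gen 35; claim DEG14-TRANSPORT addendum #3 /
preparation of the degree-16 and degree-18 rungs; sequel of `CorCM/FaceCensusOrbitTransversal.lean`).  Pure list combinatorics over seat
b30ʼs bitmask model: three small Boolean CHECKERS (definitions) and the theorems that turn them into the hypotheses of
`FaceCensus.hgen_of_certOK_coverTrans`; no named fact, nothing geometric, nothing asserted.  HONEST FRAMING (COORDINATOR RULING — HODGE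
FRAMING CORRECTION, 2026-08-21T11:55:35Z): `HC_CM` is NOT proved, here or anywhere in the tree.  T5: n/a-class (closed list data and the
ordinary dictionary `(Γ, e)` only).
-/
import Summits.HodgeConjecture.CorCM.FaceCensusOrbitTransversal
import HarnessLib

/-!
# Hinted side checks for the census transport (linear-time kernel verification)

WHY.  The side checks consumed by `FaceCensus.hgen_of_certOK_coverTrans` are QUADRATIC as written: `certOK` tests every generator face of a
certificate by a scan of the whole face list `Γ.faces` (`inOrbits`), the cover hypothesis tests every transversal face against the whole
list of twisted certified corner sets, and the orbit-cell hypothesis rebuilds every cell for every generator term.  At degree 14 this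
already forced 25 + 12 separate kernel theorems (`Census/TetradecicFaceTransportCyclic{Certs,Checks}.lean`, kernel memory guard); at
degree 16 (`14336` faces, `256` types, `112` certificates) and 18 (`36864` faces) it is out of reach.  This file replaces the three scans by
LINEAR checks and proves that they imply the original hypotheses VERBATIM, so the transport theorem is reused unchanged:

* `isFaceB` — a face is recognised by `isCMType` + two `places` look-ups instead of a scan of `Γ.faces` (`mem_faces_of_isFaceB`);
  `certOKFast` = `certOK` with `isFaceB` (`certOK_of_certOKFast`, `certsOK_of_fast`);
* `coverHintOK` + `hintFacesComplete` — the cover is checked against an explicit HINT list `(face, certificate index, twist)`, one entry per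
  face with type in the transversal, in the canonical order of `Γ.faces` (`cover_of_hints`);
* `cellsFlat` — the orbit cells of the generating representatives are computed ONCE as a flat list (`horb_of_cellsFlat`).

`hgen_of_hintedChecks` packages them: same conclusion as `hgen_of_certOK_coverTrans`, hypotheses = the five cheap Boolean identities +
the dictionary + the face readings.  References: [cite: Pohlmann1968, Thm. 1]; [cite: Milne1999LefschetzClasses, Thm. 3.2].
-/

noncomputable section

open NumberField NumberField.ComplexEmbedding

namespace Summit.HodgeConjecture.CorCM.Census.FaceSquaresModel

namespace CMGaloisType

variable {n : ℕ} (Γ : CMGaloisType n)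

/-- Fast face test: `T` a CM type code (`< 2 ^ n`, `isCMType`), `p ≠ q` two place masks of the model. [folklore] -/
def isFaceB (g : ℕ × ℕ × ℕ) : Bool :=
  decide (g.1 < 2 ^ n) && Γ.isCMType g.1 && Γ.places.contains g.2.1 && Γ.places.contains g.2.2 && (g.2.2 != g.2.1)

/-- `certOK` with the generator faces recognised by `isFaceB` instead of a scan of `Γ.faces`. [folklore] -/
def certOKFast (𝒮 : List (ℕ × ℕ × ℕ)) (f : ℕ × ℕ × ℕ) (fc : List ((ℕ × ℕ × ℕ) × ℤ)) (pc : List (ℕ × ℤ)) : Bool :=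
  (fc.all fun gi => Γ.isFaceB gi.1 && 𝒮.any fun r => Γ.isTwistOf (square r) (square gi.1)) &&
    Γ.cmTypes.all fun L => (if (Γ.corners f).contains L then (1 : ℤ) else 0) == Γ.comboVal fc pc L

/-- The eight faces of the orbit cell of the representative `r` twisted by `j` (both orders of the two places, all four types of the
square as base type). [folklore] -/
def cell8 (r : ℕ × ℕ × ℕ) (j : Fin n) : List (ℕ × ℕ × ℕ) :=
  [(Γ.twist j r.1, Γ.twist j r.2.1, Γ.twist j r.2.2),
    (flipAt (Γ.twist j r.2.1) (Γ.twist j r.1), Γ.twist j r.2.1, Γ.twist j r.2.2),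
    (flipAt (Γ.twist j r.2.2) (Γ.twist j r.1), Γ.twist j r.2.1, Γ.twist j r.2.2),
    (flipAt (Γ.twist j r.2.2) (flipAt (Γ.twist j r.2.1) (Γ.twist j r.1)), Γ.twist j r.2.1, Γ.twist j r.2.2),
    (Γ.twist j r.1, Γ.twist j r.2.2, Γ.twist j r.2.1),
    (flipAt (Γ.twist j r.2.1) (Γ.twist j r.1), Γ.twist j r.2.2, Γ.twist j r.2.1),
    (flipAt (Γ.twist j r.2.2) (Γ.twist j r.1), Γ.twist j r.2.2, Γ.twist j r.2.1),
    (flipAt (Γ.twist j r.2.2) (flipAt (Γ.twist j r.2.1) (Γ.twist j r.1)), Γ.twist j r.2.2, Γ.twist j r.2.1)]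

/-- All orbit cells of all representatives, as ONE flat list (computed once by the kernel). [folklore] -/
def cellsFlat (𝒮 : List (ℕ × ℕ × ℕ)) : List (ℕ × ℕ × ℕ) :=
  𝒮.flatMap fun r => (List.finRange n).flatMap fun j => Γ.cell8 r j

/-- Hinted cover check: every hint `(φ, i, j)` says «the normalised corner set of the face `φ` is the normalised corner set of the `j`-twist
of the `i`-th certified face». [folklore] -/
def coverHintOK (cs : List ((ℕ × ℕ × ℕ) × List ((ℕ × ℕ × ℕ) × ℤ) × List (ℕ × ℤ))) (hints : List ((ℕ × ℕ × ℕ) × ℕ × Fin n)) : Bool :=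
  hints.all fun h => match cs[h.2.1]? with
    | none => false
    | some c => normalize (Γ.corners h.1) == normalize (Γ.corners (Γ.twist h.2.2 c.1.1, Γ.twist h.2.2 c.1.2.1, Γ.twist h.2.2 c.1.2.2))

/-- The faces of the model with type in `trans`, in the canonical order of `Γ.faces`. [folklore] -/
def transFaces (trans : List ℕ) : List (ℕ × ℕ × ℕ) :=
  trans.flatMap fun T => Γ.places.flatMap fun p => (Γ.places.filter fun q => q != p).map fun q => (T, p, q)

/-- Completeness of a hint list: its faces ARE the faces with type in `trans`, in canonical order. [folklore] -/
def hintFacesComplete (trans : List ℕ) (hints : List ((ℕ × ℕ × ℕ) × ℕ × Fin n)) : Bool :=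
  hints.map (fun h => h.1) == Γ.transFaces trans

end CMGaloisType

end Summit.HodgeConjecture.CorCM.Census.FaceSquaresModel

namespace Summit.HodgeConjecture.CorCM.FaceCensus

open Literature.AlgebraicGeometry.Motives (CMType)
open Literature.NumberTheory.ComplexMultiplication.CMTypeOps
open Summit.HodgeConjecture.CorCM.Prior.AllgGroup.RfwfAllgGroup
open Summit.HodgeConjecture.CorCM.Census.FaceSquaresModel

variable {F : Type} [Field F] [NumberField F] [IsGalois ℚ F]
variable {n : ℕ} (Γ : CMGaloisType n) (e : GalT F ≃ Fin n)

omit [IsGalois ℚ F] in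
/-- A triple passing the fast face test is a face of the model. [folklore] -/
theorem mem_faces_of_isFaceB {g : ℕ × ℕ × ℕ} (h : Γ.isFaceB g = true) : g ∈ Γ.faces := by
  obtain ⟨T, p, q⟩ := g
  simp only [CMGaloisType.isFaceB, Bool.and_eq_true, decide_eq_true_eq, bne_iff_ne, ne_eq] at h
  obtain ⟨⟨⟨⟨hlt, hcm⟩, hp⟩, hq⟩, hne⟩ := h
  exact mem_faces_of Γ ((mem_cmTypes_iff Γ T).mpr ⟨hlt, hcm⟩) (List.mem_of_elem_eq_true hp)
    (List.mem_of_elem_eq_true hq) hne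

/-- Characterisation of the faces of the model. [folklore] -/
theorem mem_faces_iff (g : ℕ × ℕ × ℕ) :
    g ∈ Γ.faces ↔ g.1 ∈ Γ.cmTypes ∧ g.2.1 ∈ Γ.places ∧ g.2.2 ∈ Γ.places ∧ g.2.2 ≠ g.2.1 := by
  obtain ⟨T, p, q⟩ := g
  constructor
  · intro h
    unfold CMGaloisType.faces at h
    simp only [List.mem_flatMap, List.mem_map, List.mem_filter, bne_iff_ne, ne_eq, Prod.mk.injEq] at h
    obtain ⟨T', hT', p', hp', q', ⟨hq', hne⟩, rfl, rfl, rfl⟩ := h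
    exact ⟨hT', hp', hq', hne⟩
  · rintro ⟨hT, hp, hq, hne⟩
    exact mem_faces_of Γ hT hp hq hne

/-- The fast certificate check implies b30ʼs `certOK`. [folklore] -/
theorem certOK_of_certOKFast {𝒮 : List (ℕ × ℕ × ℕ)} {f : ℕ × ℕ × ℕ} {fc : List ((ℕ × ℕ × ℕ) × ℤ)} {pc : List (ℕ × ℤ)}
    (h : Γ.certOKFast 𝒮 f fc pc = true) : Γ.certOK 𝒮 f fc pc = true := by
  unfold CMGaloisType.certOKFast at h
  unfold CMGaloisType.certOK CMGaloisType.inOrbits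
  simp only [Bool.and_eq_true, List.all_eq_true] at h ⊢
  obtain ⟨hfc, hL⟩ := h
  refine ⟨fun gi hgi => ?_, hL⟩
  obtain ⟨hface, hany⟩ := hfc gi hgi
  exact ⟨List.elem_eq_true_of_mem (mem_faces_of_isFaceB Γ hface), hany⟩

/-- The fast form of side check 3 implies the form consumed by `hgen_of_certOK_coverTrans`. [folklore] -/
theorem certsOK_of_fast (reps : List (ℕ × ℕ × ℕ)) (cs : List ((ℕ × ℕ × ℕ) × List ((ℕ × ℕ × ℕ) × ℤ) × List (ℕ × ℤ)))
    (h : (cs.all fun c => Γ.isFaceB c.1 && Γ.certOKFast reps c.1 c.2.1 c.2.2) = true) :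
    (cs.all fun c => Γ.faces.contains c.1 && Γ.certOK reps c.1 c.2.1 c.2.2) = true := by
  rw [List.all_eq_true] at h ⊢
  intro c hc
  have h' := h c hc
  rw [Bool.and_eq_true] at h' ⊢
  exact ⟨List.elem_eq_true_of_mem (mem_faces_of_isFaceB Γ h'.1), certOK_of_certOKFast Γ h'.2⟩

/-- The flat orbit-cell check implies the nested form consumed by `hgen_of_certOK_coverTrans`. [folklore] -/
theorem horb_of_cellsFlat (reps : List (ℕ × ℕ × ℕ)) (cs : List ((ℕ × ℕ × ℕ) × List ((ℕ × ℕ × ℕ) × ℤ) × List (ℕ × ℤ)))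
    (h : (cs.all fun c => c.2.1.all fun gi => (Γ.cellsFlat reps).contains gi.1) = true) :
    (cs.all fun c => c.2.1.all fun gi => reps.any fun r => (List.finRange n).any fun j =>
      [(Γ.twist j r.1, Γ.twist j r.2.1, Γ.twist j r.2.2),
        (flipAt (Γ.twist j r.2.1) (Γ.twist j r.1), Γ.twist j r.2.1, Γ.twist j r.2.2),
        (flipAt (Γ.twist j r.2.2) (Γ.twist j r.1), Γ.twist j r.2.1, Γ.twist j r.2.2),
        (flipAt (Γ.twist j r.2.2) (flipAt (Γ.twist j r.2.1) (Γ.twist j r.1)), Γ.twist j r.2.1, Γ.twist j r.2.2),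
        (Γ.twist j r.1, Γ.twist j r.2.2, Γ.twist j r.2.1),
        (flipAt (Γ.twist j r.2.1) (Γ.twist j r.1), Γ.twist j r.2.2, Γ.twist j r.2.1),
        (flipAt (Γ.twist j r.2.2) (Γ.twist j r.1), Γ.twist j r.2.2, Γ.twist j r.2.1),
        (flipAt (Γ.twist j r.2.2) (flipAt (Γ.twist j r.2.1) (Γ.twist j r.1)), Γ.twist j r.2.2, Γ.twist j r.2.1)].contains gi.1)
      = true := by
  rw [List.all_eq_true] at h ⊢
  intro c hc
  have hc' := h c hc
  rw [List.all_eq_true] at hc' ⊢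
  intro gi hgi
  have hg := List.mem_of_elem_eq_true (hc' gi hgi)
  unfold CMGaloisType.cellsFlat at hg
  rw [List.mem_flatMap] at hg
  obtain ⟨r, hr, hg⟩ := hg
  rw [List.mem_flatMap] at hg
  obtain ⟨j, hj, hg⟩ := hg
  rw [List.any_eq_true]
  refine ⟨r, hr, ?_⟩
  rw [List.any_eq_true]
  exact ⟨j, hj, List.elem_eq_true_of_mem hg⟩

/-- The hinted cover check implies the list-form cover hypothesis of `hgen_of_certOK_coverTrans`. [folklore] -/
theorem cover_of_hints (cs : List ((ℕ × ℕ × ℕ) × List ((ℕ × ℕ × ℕ) × ℤ) × List (ℕ × ℤ))) (trans : List ℕ)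
    (hints : List ((ℕ × ℕ × ℕ) × ℕ × Fin n)) (hok : Γ.coverHintOK cs hints = true)
    (hcomp : Γ.hintFacesComplete trans hints = true) :
    (Γ.faces.all fun φ => !(trans.contains φ.1) || (cs.flatMap fun c => (List.finRange n).map fun j =>
        normalize (Γ.corners (Γ.twist j c.1.1, Γ.twist j c.1.2.1, Γ.twist j c.1.2.2))).contains (normalize (Γ.corners φ))) = true := by
  rw [List.all_eq_true]
  intro φ hφ
  rw [Bool.or_eq_true]
  by_cases ht : trans.contains φ.1 = true
  · right
    -- `φ` is one of the hinted faces
    have hmem : φ ∈ Γ.transFaces trans := by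
      obtain ⟨hT, hp, hq, hne⟩ := (mem_faces_iff Γ φ).mp hφ
      unfold CMGaloisType.transFaces
      rw [List.mem_flatMap]
      refine ⟨φ.1, List.mem_of_elem_eq_true ht, ?_⟩
      rw [List.mem_flatMap]
      refine ⟨φ.2.1, hp, ?_⟩
      rw [List.mem_map]
      exact ⟨φ.2.2, List.mem_filter.mpr ⟨hq, bne_iff_ne.mpr hne⟩, rfl⟩
    unfold CMGaloisType.hintFacesComplete at hcomp
    rw [beq_iff_eq] at hcomp
    rw [← hcomp, List.mem_map] at hmem
    obtain ⟨h, hh, rfl⟩ := hmem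
    unfold CMGaloisType.coverHintOK at hok
    rw [List.all_eq_true] at hok
    have hk := hok h hh
    cases hci : cs[h.2.1]? with
    | none => simp [hci] at hk
    | some c =>
      simp only [hci, beq_iff_eq] at hk
      rw [hk]
      apply List.elem_eq_true_of_mem
      rw [List.mem_flatMap]
      refine ⟨c, List.mem_of_getElem? hci, ?_⟩
      rw [List.mem_map]
      exact ⟨h.2.2, List.mem_finRange _, rfl⟩
  · left
    simpa using ht

/-- **The census transport with HINTED side checks.**  Same conclusion as `hgen_of_certOK_coverTrans`; the census hypotheses are the
five linear-time Boolean identities: (3′) `isFaceB`/`certOKFast` for every certificate, (4a) every CM type twists into the transversal,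
(4b′) the hinted cover + completeness of the hint list, (1′) the flat orbit-cell check, (2) the pair labels are CM types. [cite:
Pohlmann1968, Thm. 1] [cite: Milne1999LefschetzClasses, Thm. 3.2] -/
theorem hgen_of_hintedChecks (hmul : ∀ P Q : GalT F, e (P * Q) = Γ.mul (e P) (e Q)) (hconj : e conjT = Γ.conj)
    (reps : List (ℕ × ℕ × ℕ)) (cs : List ((ℕ × ℕ × ℕ) × List ((ℕ × ℕ × ℕ) × ℤ) × List (ℕ × ℤ)))
    (hcs : (cs.all fun c => Γ.isFaceB c.1 && Γ.certOKFast reps c.1 c.2.1 c.2.2) = true)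
    (trans : List ℕ) (htrans : (Γ.cmTypes.all fun T => (List.finRange n).any fun j => trans.contains (Γ.twist j T)) = true)
    (hints : List ((ℕ × ℕ × ℕ) × ℕ × Fin n)) (hok : Γ.coverHintOK cs hints = true)
    (hcomp : Γ.hintFacesComplete trans hints = true)
    (horb : (cs.all fun c => c.2.1.all fun gi => (Γ.cellsFlat reps).contains gi.1) = true)
    (hpc : (cs.all fun c => c.2.2.all fun pj => Γ.isCMType pj.1) = true)
    (σ₀ : F →+* ℂ) (𝒮 : Set (Face F))
    (hreps : ∀ r ∈ reps, ∃ R ∈ 𝒮, (r.1 < 2 ^ n ∧ ∀ i : Fin n, mem i r.1 = true ↔ e.symm i ∈ (pullType R.Φ σ₀).1) ∧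
      Γ.placeMask (e (translate σ₀ R.p)) = r.2.1 ∧ Γ.placeMask (e (translate σ₀ R.p')) = r.2.2)
    (f : Face F) :
    lefChar f.corner (fun _ => ({σ₀} : Finset (F →+* ℂ))) ∈ AddSubgroup.closure
      {a : Asym F | ∃ g ∈ 𝒮, ∃ σ : F →+* ℂ, a = lefChar g.corner (fun _ => ({σ} : Finset (F →+* ℂ)))} :=
  hgen_of_certOK_coverTrans Γ e hmul hconj reps cs (certsOK_of_fast Γ reps cs hcs) trans htrans
    (cover_of_hints Γ cs trans hints hok hcomp) (horb_of_cellsFlat Γ reps cs horb) hpc σ₀ 𝒮 hreps f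

end Summit.HodgeConjecture.CorCM.FaceCensus

end
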